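import Summits.QuantumFields.BalabanUV.T4Continuum.Support.B13TermOpSecantWitness
import Summits.QuantumFields.BalabanUV.T4Continuum.Support.OutputRateActOpFibre

/-!
# NE5 ∕ U3 — W2 OPERATOR half at activity level, FIBRE route: NON-VACUITY WITNESS for the row owner's chain
# `OutputRateActOpFibre.ActOpIntegral ⟹ ActOpFibre ⟹ ActOpBound ∧ ActOpLip ⟹ OpLipschitz` (one-polymer Ursell family `exp(o + h)`
# on the lineage's BASED toy model), the constant it produces vs the secant route's, and NEGATIVE CONTROLS on the unbased toy

Cell `pub-balaban`, unit `b2b-balaban-t4-ne5-formalise-leaf-03` (NE5 formalisation swarm, LEAF PROVER 03, gen 5; follower of the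
lineage's `Support/B13TermOpSecantWitness.lean` p213498 (secant route, through route P2's `B13TermOpSecant` p212487), fired here
through the row owner's `Support/OutputRateActOpFibre.lean` p213673 (unit `b2b-balaban-t4-ne5-p1`, gen 28), at the owner's
invitation (journal l.9612)).  Summits-side bookkeeping under the LEAN PLACEMENT RULE.  A TOY — nothing of [Balaban1988RG2Cluster]
is modelled; no new definition (the toy objects `oneIndexing`, `topInc`, `toyModel`, `boxModel`, `toyAct` are the tree's; the
parametric-integral data of §2 are anonymous functions).  HONEST FRAMING: rung (B)+1 of the FINITE-VOLUME T⁴ programme — NOT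
infinite volume, NOT a mass gap, NOT the Clay problem, NOT NE5 (NOT PRINTED; GAPS G-t4-U3-1), and NOT the wall W2-op
(G-ne5p1-1′∕1″): for the (2.14) factors of [II] the shapes `ActOpFibre`∕`ActOpIntegral` — (H-rep) and the MARGIN on the complex
operator ball — stay DISPLAYED ∕ NOT PRINTED; this file only shows that the owner's binder lists are JOINTLY SATISFIABLE by a genuinely
operator-dependent activity, that both producers then fire BY NAME, and what constant comes out.
HONEST DEPENDENCY (cell line, verbatim): continuum YM on T⁴ ⇐ BetaPertH ∧ nine spine estimates (0/9 proved); BetaPertH ⇐ (D1) ∧ (D4) ∧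
CAP+tail; G-an2-4 gates asym, D1 and NE2/3/4.

WHAT.  On the based toy `B13TermHistEnvelopeWitness.boxModel` (output `exp(o + h)` as the one-polymer Ursell series over
`B13TermHistSecantWitness.oneIndexing`∕`topInc`, base `B̄(0,1) × B̄(0,1)`, unit margins):
* §1 `box_actOpFibre` — **`ActOpFibre oneIndexing toyAct boxModel univ (A ≡ e³)`** directly: along an operator line `p.1 + ζu`,
  `‖u‖ ≤ rOp = 1`, the factor `ζ ↦ e^{p.1 + ζu + p.2}` is entire, and on the closed unit disc `‖p.1 + ζu‖ ≤ 2` so it is `≤ e³`;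
* §2 `box_actOpIntegral` — **the STRUCTURAL class `ActOpIntegral oneIndexing toyAct boxModel univ (A ≡ e³) μ f 𝒪` is INHABITED** with
  `μ ≡` the Dirac mass on `Unit`, `f ≡ (h, o, a) ↦ e^{o}·e^{h}`, `𝒪 ≡ univ`: every one of its six clauses holds with explicit data
  (closed operator ball `⊆ univ`; a.e.-strong measurability of a constant; holomorphy of `o ↦ e^{o}·e^{h}`; LOCAL domination on
  `ball o₀ 1` by the constant `e^{‖o₀‖+1}·e`; ONE closed-ball majorant `≡ e³` of mass `e³ ≤ A`; the representation
  `e^{o+h} = ∫ e^{o}e^{h} dδ`) — hence `ActOpFibre` AGAIN, now by `actOpFibre_of_integral` BY NAME (`box_actOpFibre_of_integral`);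
* §3 the produced currencies of route P2 (`ActOpBound` as the lineage's `box_actOpBound` — same statement, re-obtained —, and
  `box_actOpLip_fibre`: modulus `N ≡ 1∕(1 − ρ₀)`), the secant
  budget `Σ' secMajorant (N ≡ 1∕(1−ρ₀)) (A ≡ e³) = e³∕(1 − ρ₀)` at rate `0`, and **`toy_opLipschitz_fibre :
  OpLipschitz boxModel univ 0 (e³∕(1 − ρ₀)) ρ₀`** for `0 ≤ ρ₀ < 1` = the owner's `opLipschitz_b13_of_actOpFibre` APPLIED BY NAME
  (`hM := rfl`), and `toy_opLipschitz_integral` = the same through the WHOLE chain from `ActOpIntegral`; read back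
  (`toy_opReading_fibre`): `‖e^{o+h} − e^{o₀+h}‖ ≤ (e³∕(1−ρ₀))·‖o − o₀‖` for `‖o₀‖, ‖h‖ ≤ 1`, `‖o − o₀‖ ≤ ρ₀`;
* §4 COMPARISON with the secant route's constant `2e³` of `B13TermOpSecantWitness.toy_opLipschitz` (activity-specific modulus
  `N ≡ 2`, valid up to `ρ₀ = 1`): the fibre route's universal `e³∕(1 − ρ₀)` is the smaller one iff `ρ₀ ≤ ½` (`fibre_le_secant_iff`)
  and exceeds any bound as `ρ₀ → 1` (`fibre_unbounded`) — the price of the universal modulus `1∕(1 − ρ₀)`;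
* §5 NEGATIVE CONTROLS: on the UNBASED toy `B13TermHistSecantWitness.toyModel` (`Base := univ`) **`ActOpFibre` and `ActOpIntegral`
  FAIL for EVERY majorant `A`** (and every measure ∕ integrand ∕ domain) — two-line corollaries of the owner's `actOpBound_of_fibre` ∕
  `actOpFibre_of_integral` and the lineage's `not_actOpBound_toyModel` BY NAME: like P2's sufficient condition, the fibre shapes need
  the base's bound on the OPERATOR coordinate.
0 sorry; axioms ⊆ {propext, Classical.choice, Quot.sound}.
-/

noncomputable section

open MeasureTheory Metric Set
open scoped BigOperators

namespace Summit.QuantumFields.BalabanUV.T4Continuum.B13TermOpFibreWitness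

open Literature.MathematicalPhysics.QuantumFieldTheory.Balaban1983to89.T4OutputRate (Carriers)
open Literature.MathematicalPhysics.QuantumFieldTheory.Balaban1983to89.T4InputCauchyRate (toyCarriers)
open Literature.MathematicalPhysics.QuantumFieldTheory.Balaban1983to89.T4InputCauchyRateData (StepModel)
open Literature.MathematicalPhysics.QuantumFieldTheory.Balaban1983to89.T4InputCauchyRateSpecies (OpLipschitz)
open Summit.QuantumFields.BalabanUV.T4Continuum.B13StepTermFamily (toyAct)
open Summit.QuantumFields.BalabanUV.T4Continuum.B13TermRep (actMajorant)
open Summit.QuantumFields.BalabanUV.T4Continuum.B13TermHistSecant (secMajorant)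
open Summit.QuantumFields.BalabanUV.T4Continuum.B13TermHistSecantWitness (oneIndexing topInc toyModel)
open Summit.QuantumFields.BalabanUV.T4Continuum.B13TermHistEnvelopeWitness (boxModel out_eq)
open Summit.QuantumFields.BalabanUV.T4Continuum.B13TermOpSecant (ActOpBound ActOpLip)
open Summit.QuantumFields.BalabanUV.T4Continuum.B13TermOpSecantWitness
  (mem_base box_opConv box_actMajorant₃ not_actOpBound_toyModel)
open Summit.QuantumFields.BalabanUV.T4Continuum.OutputRateActOpFibre
  (ActOpFibre ActOpIntegral actOpBound_of_fibre actOpLip_of_fibre opLipschitz_b13_of_actOpFibre actOpFibre_of_integral)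

/-! ## §1 The fibre shape holds on the based toy (direct) -/

/-- [folklore] Along an operator line through a base point (`‖p.1‖ ≤ 1`) in a direction within the unit margin (`‖u‖ ≤ 1`), the closed
unit disc stays in the ball `‖·‖ ≤ 2`. -/
theorem norm_line_le_two {p₁ u ζ : ℂ} (hp1 : ‖p₁‖ ≤ 1) (hu : ‖u‖ ≤ 1) (hζ : ζ ∈ closedBall (0 : ℂ) 1) : ‖p₁ + ζ • u‖ ≤ 2 := by
  rw [mem_closedBall, dist_zero_right] at hζ
  calc ‖p₁ + ζ • u‖ ≤ ‖p₁‖ + ‖ζ • u‖ := norm_add_le _ _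
    _ ≤ 1 + 1 * 1 := by
        rw [norm_smul]; exact add_le_add hp1 (mul_le_mul hζ hu (norm_nonneg _) zero_le_one)
    _ = 2 := by norm_num

/-- [folklore] **`ActOpFibre` ON THE BASED TOY** with the constant majorant `A ≡ e³`: `ζ ↦ e^{p.1 + ζu + p.2}` is entire and on the
closed unit disc `‖e^{p.1 + ζu + p.2}‖ = e^{Re(p.1 + ζu) + Re p.2} ≤ e^{2+1}`. -/
theorem box_actOpFibre : ActOpFibre oneIndexing toyAct boxModel Set.univ fun _ _ _ _ _ => Real.exp 3 := by
  intro k g _ U p hp X _ i _ m u hu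
  obtain ⟨hp1, hp2⟩ := mem_base hp
  have hr : boxModel.rOp k = 1 := rfl
  rw [hr] at hu
  refine ⟨?_, fun ζ hζ => ?_⟩
  · show DifferentiableOn ℂ (fun ζ : ℂ => Complex.exp (p.1 + ζ • u + p.2)) (closedBall 0 1)
    exact ((((differentiable_id.smul_const u).const_add p.1).add_const p.2).cexp).differentiableOn
  · show ‖Complex.exp (p.1 + ζ • u + p.2)‖ ≤ Real.exp 3
    rw [Complex.norm_exp, Complex.add_re]
    exact Real.exp_le_exp.2
      (by linarith [(Complex.re_le_norm _).trans (norm_line_le_two hp1 hu hζ), (Complex.re_le_norm p.2).trans hp2])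

/-! ## §2 The structural class is inhabited: `exp(o + h)` as a dominated holomorphic parametric integral of the operator datum -/

/-- [folklore] **`ActOpIntegral` ON THE BASED TOY**: with the Dirac mass on `Unit` as the factor measure, the integrand
`(h, o, a) ↦ e^{o}·e^{h}` and the operator domain `univ`, every clause of the owner's structural shape holds with explicit data —
closed operator ball `⊆ univ`; a.e.-strong measurability of a constant; `o ↦ e^{o}·e^{h}` entire; LOCAL domination on `ball o₀ 1` by
the constant `e^{‖o₀‖+1}·e¹` (`‖h‖ ≤ 1` at a base point); closed-ball majorant `≡ e³` (`‖o‖ ≤ 2` there) of mass `e³ ≤ A ≡ e³`;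
representation `e^{o+h} = ∫ e^{o}·e^{h} dδ`. -/
theorem box_actOpIntegral :
    ActOpIntegral oneIndexing toyAct boxModel Set.univ (fun _ _ _ _ _ => Real.exp 3) (α := fun _ _ => Unit)
      (fun _ _ _ _ => Measure.dirac ()) (fun _ _ _ h o _ => Complex.exp o * Complex.exp h) fun _ _ _ _ _ _ => Set.univ := by
  intro k g _ U p hp X _ i _ m
  obtain ⟨hp1, hp2⟩ := mem_base hp
  have hr : boxModel.rOp k = 1 := rfl
  dsimp only
  refine ⟨subset_univ _, fun _ _ => aestronglyMeasurable_const, Filter.Eventually.of_forall fun _ => ?_, fun o₀ _ => ?_,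
    ⟨fun _ => Real.exp 3, integrable_const _, Filter.Eventually.of_forall fun _ o ho => ?_, ?_⟩, fun o _ => ?_⟩
  · exact (Complex.differentiable_exp.mul_const _).differentiableOn
  · refine ⟨1, one_pos, subset_univ _, fun _ => Real.exp (‖o₀‖ + 1) * Real.exp 1, integrable_const _,
      Filter.Eventually.of_forall fun _ o ho => ?_⟩
    rw [mem_ball, dist_eq_norm] at ho
    rw [norm_mul, Complex.norm_exp, Complex.norm_exp]
    refine mul_le_mul (Real.exp_le_exp.2 ?_) (Real.exp_le_exp.2 ((Complex.re_le_norm _).trans hp2)) (Real.exp_pos _).le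
      (Real.exp_pos _).le
    calc o.re ≤ ‖o‖ := Complex.re_le_norm o
      _ = ‖(o - o₀) + o₀‖ := by rw [sub_add_cancel]
      _ ≤ ‖o - o₀‖ + ‖o₀‖ := norm_add_le _ _
      _ ≤ ‖o₀‖ + 1 := by linarith
  · rw [hr, mem_closedBall, dist_eq_norm] at ho
    have ho2 : ‖o‖ ≤ 2 :=
      calc ‖o‖ = ‖(o - p.1) + p.1‖ := by rw [sub_add_cancel]
        _ ≤ ‖o - p.1‖ + ‖p.1‖ := norm_add_le _ _
        _ ≤ 1 + 1 := add_le_add ho hp1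
        _ = 2 := by norm_num
    rw [norm_mul, Complex.norm_exp, Complex.norm_exp, ← Real.exp_add]
    exact Real.exp_le_exp.2 (by linarith [(Complex.re_le_norm o).trans ho2, (Complex.re_le_norm p.2).trans hp2])
  · rw [integral_dirac]
  · show Complex.exp (o + p.2) = ∫ _ : Unit, Complex.exp o * Complex.exp p.2 ∂(Measure.dirac ())
    rw [integral_dirac, Complex.exp_add]

/-- [folklore] **THE STRUCTURAL PRODUCER FIRES**: `ActOpIntegral ⟹ ActOpFibre` (`actOpFibre_of_integral` BY NAME) on the based toy —
the same conclusion as §1, now obtained through the owner's §4 (each operator line stays in the closed operator ball `⊆ univ`; Cauchy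
for dominated holomorphic integrals). -/
theorem box_actOpFibre_of_integral : ActOpFibre oneIndexing toyAct boxModel Set.univ fun _ _ _ _ _ => Real.exp 3 :=
  actOpFibre_of_integral box_actOpIntegral

/-! ## §3 The produced currencies, the fibre budget, and the owner's `OpLipschitz` producer BY NAME -/

/-- [folklore] Route P2's `ActOpBound` PRODUCED from the fibre shape (`actOpBound_of_fibre`), reach `ρ₀ ≤ 1` — the SAME statement as
the lineage's hand-made `B13TermOpSecantWitness.box_actOpBound` (hence an `example`, not a second declaration of record). -/
example {ρ₀ : ℝ} (hρ₁ : ρ₀ ≤ 1) : ActOpBound oneIndexing toyAct boxModel Set.univ ρ₀ fun _ _ _ _ _ => Real.exp 3 :=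
  actOpBound_of_fibre box_actOpFibre hρ₁

/-- [folklore] Route P2's `ActOpLip` PRODUCED from the fibre shape (`actOpLip_of_fibre`) with the UNIVERSAL modulus `N ≡ 1∕(1 − ρ₀)`
against `A ≡ e³`, reach `ρ₀ < 1` (compare the lineage's hand-made `box_actOpLip`: `N ≡ 2` up to `ρ₀ = 1`). -/
theorem box_actOpLip_fibre {ρ₀ : ℝ} (hρ₁ : ρ₀ < 1) :
    ActOpLip oneIndexing toyAct boxModel Set.univ ρ₀ (fun _ _ _ _ _ => 1 / (1 - ρ₀)) fun _ _ _ _ _ => Real.exp 3 :=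
  actOpLip_of_fibre box_actOpFibre hρ₁

/-- [folklore] The induced secant majorant with modulus `1∕(1 − ρ₀)` is the constant `e³∕(1 − ρ₀)` (one factor). -/
theorem box_secMajorant_fibre (ρ₀ : ℝ) {k : ℕ} {X : toyCarriers.Dom} (hX : toyCarriers.scale X = k) (i : Unit) :
    secMajorant oneIndexing topInc (fun _ _ => 1 / (1 - ρ₀)) (fun _ _ => Real.exp 3) k X i = Real.exp 3 / (1 - ρ₀) := by
  rw [secMajorant, box_actMajorant₃ hX]
  show (∑ _m : Fin (0 + 1), (1 / (1 - ρ₀) : ℝ)) * Real.exp 3 = Real.exp 3 / (1 - ρ₀)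
  simp [div_eq_inv_mul]

/-- [folklore] THE FIBRE-ROUTE SECANT BUDGET at rate `0`: `Σ'ᵢ secMajorant (N ≡ 1∕(1−ρ₀)) (A ≡ e³) = e³∕(1−ρ₀) ≤ (e³∕(1−ρ₀))·e^{−0·d(X)}`. -/
theorem box_fibreBudget (ρ₀ : ℝ) : ∀ k, ∀ g ∈ (Set.univ : Set (ℕ → ℝ)), ∀ (U : toyCarriers.BgB) (X : toyCarriers.Dom),
    toyCarriers.scale X = k →
    Summable (secMajorant oneIndexing topInc (fun _ _ => 1 / (1 - ρ₀))
      ((fun (_ : ℕ) (_ : ℕ → ℝ) (_ : toyCarriers.BgB) (_ : Unit) (_ : Unit) => Real.exp 3) k g U) k X) ∧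
      ∑' i, secMajorant oneIndexing topInc (fun _ _ => 1 / (1 - ρ₀))
        ((fun (_ : ℕ) (_ : ℕ → ℝ) (_ : toyCarriers.BgB) (_ : Unit) (_ : Unit) => Real.exp 3) k g U) k X i ≤
        Real.exp 3 / (1 - ρ₀) * Real.exp (-(0 * toyCarriers.d X)) := by
  intro k g _ U X hX
  refine ⟨Summable.of_finite, ?_⟩
  rw [tsum_fintype, Fintype.sum_unique, box_secMajorant_fibre ρ₀ hX, zero_mul, neg_zero, Real.exp_zero, mul_one]

/-- [folklore] **THE OWNER's OPERATOR-HALF PRODUCER FIRES ON THE BASED TOY (fibre route)**: for `0 ≤ ρ₀ < 1`, `ActOpFibre (A ≡ e³)`,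
d3 convergence (the lineage's `box_opConv`) and the fibre budget `e³∕(1−ρ₀)` at rate `0` ⟹ `OpLipschitz boxModel univ 0 (e³∕(1−ρ₀)) ρ₀`
— `OutputRateActOpFibre.opLipschitz_b13_of_actOpFibre` with `hM := rfl`, every binder discharged by explicit data. -/
theorem toy_opLipschitz_fibre {ρ₀ : ℝ} (hρ₀ : 0 ≤ ρ₀) (hρ₁ : ρ₀ < 1) :
    OpLipschitz boxModel Set.univ 0 (Real.exp 3 / (1 - ρ₀)) ρ₀ :=
  opLipschitz_b13_of_actOpFibre (𝒯 := oneIndexing) (inc := topInc) (act := toyAct) (M := boxModel) (fun _ _ _ _ => rfl) hρ₀ hρ₁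
    (fun _ _ _ _ _ => (Real.exp_pos 3).le) box_actOpFibre box_opConv (box_fibreBudget ρ₀)

/-- [folklore] **… AND THROUGH THE WHOLE CHAIN** `ActOpIntegral ⟹ ActOpFibre ⟹ (ActOpBound ∧ ActOpLip) ⟹ OpLipschitz`: the same
conclusion with `hfib := actOpFibre_of_integral box_actOpIntegral`. -/
theorem toy_opLipschitz_integral {ρ₀ : ℝ} (hρ₀ : 0 ≤ ρ₀) (hρ₁ : ρ₀ < 1) :
    OpLipschitz boxModel Set.univ 0 (Real.exp 3 / (1 - ρ₀)) ρ₀ :=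
  opLipschitz_b13_of_actOpFibre (𝒯 := oneIndexing) (inc := topInc) (act := toyAct) (M := boxModel) (fun _ _ _ _ => rfl) hρ₀ hρ₁
    (fun _ _ _ _ _ => (Real.exp_pos 3).le) box_actOpFibre_of_integral box_opConv (box_fibreBudget ρ₀)

/-- [folklore] **READING THE CONCLUSION** (non-triviality): for a base point `‖o₀‖, ‖h‖ ≤ 1` and an operator datum within reach
`‖o − o₀‖ ≤ ρ₀ < 1`, `‖e^{o+h} − e^{o₀+h}‖ ≤ (e³∕(1−ρ₀))·‖o − o₀‖`. -/
theorem toy_opReading_fibre {ρ₀ : ℝ} (hρ₀ : 0 ≤ ρ₀) (hρ₁ : ρ₀ < 1) {o₀ o h : ℂ} (ho₀ : ‖o₀‖ ≤ 1) (hh : ‖h‖ ≤ 1)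
    (ho : ‖o - o₀‖ ≤ ρ₀) : ‖Complex.exp (o + h) - Complex.exp (o₀ + h)‖ ≤ Real.exp 3 / (1 - ρ₀) * ‖o - o₀‖ := by
  have hp : ((o₀, h) : ℂ × ℂ) ∈ boxModel.Base 0 (fun _ => 0) () :=
    Set.mk_mem_prod (mem_closedBall_zero_iff.2 ho₀) (mem_closedBall_zero_iff.2 hh)
  have hr : boxModel.rOp 0 = 1 := rfl
  have hoR : ‖o - ((o₀, h) : ℂ × ℂ).1‖ ≤ ρ₀ * boxModel.rOp 0 := by rw [hr, mul_one]; exact ho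
  have key := toy_opLipschitz_fibre hρ₀ hρ₁ 0 (fun _ => 0) (Set.mem_univ _) () (o₀, h) hp (0 : ℕ) rfl o hoR
  have hd : toyCarriers.d (0 : ℕ) = 0 := rfl
  rw [out_eq (k := 0) (X := (0 : ℕ)) rfl, out_eq (k := 0) (X := (0 : ℕ)) rfl, hr, hd, div_one, mul_zero, neg_zero,
    Real.exp_zero, mul_one] at key
  exact key

/-! ## §4 The constant: fibre route `e³∕(1 − ρ₀)` vs secant route `2e³` -/

/-- [folklore] **WHICH ROUTE GIVES THE SMALLER TOY CONSTANT**: the fibre route's `e³∕(1 − ρ₀)` (universal modulus `1∕(1 − ρ₀)`) is at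
most the secant route's `2e³` (`B13TermOpSecantWitness.toy_opLipschitz`, activity-specific modulus `N ≡ 2`) iff `ρ₀ ≤ ½`. -/
theorem fibre_le_secant_iff {ρ₀ : ℝ} (hρ₁ : ρ₀ < 1) : Real.exp 3 / (1 - ρ₀) ≤ 2 * Real.exp 3 ↔ ρ₀ ≤ 1 / 2 := by
  have h1 : 0 < 1 - ρ₀ := sub_pos.2 hρ₁
  have h3 := Real.exp_pos 3
  rw [div_le_iff₀ h1]
  constructor
  · intro h; nlinarith
  · intro h; nlinarith

/-- [folklore] … and the fibre route's constant exceeds every bound as the reach tends to the margin: for every `B` there is a reach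
`ρ₀ ∈ [½, 1)` with `B < e³∕(1 − ρ₀)` (the secant route's `2e³` stays valid up to `ρ₀ = 1`). -/
theorem fibre_unbounded (B : ℝ) : ∃ ρ₀ : ℝ, 1 / 2 ≤ ρ₀ ∧ ρ₀ < 1 ∧ B < Real.exp 3 / (1 - ρ₀) := by
  have h3 : 1 ≤ Real.exp 3 := Real.one_le_exp (by norm_num)
  refine ⟨1 - 1 / (max B 2 + 1), ?_, ?_, ?_⟩
  · have : 1 / (max B 2 + 1) ≤ 1 / 2 := by
      rw [div_le_div_iff₀ (by positivity) (by norm_num)]; linarith [le_max_right B 2]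
    linarith
  · have : 0 < 1 / (max B 2 + 1) := by positivity
    linarith
  · rw [sub_sub_cancel, div_div_eq_mul_div, div_one]
    nlinarith [le_max_left B 2, le_max_right B 2]

/-! ## §5 Negative controls: the UNBASED toy violates both fibre shapes -/

/-- [folklore] **THE FIBRE SHAPE NEEDS A BOUNDED BASE**: on the lineage's unbased secant toy `toyModel` (`Base := univ`) `ActOpFibre` FAILS
for EVERY majorant family `A` — it would produce `ActOpBound … 0 A` (`actOpBound_of_fibre`), refuted by
`B13TermOpSecantWitness.not_actOpBound_toyModel`. -/
theorem not_actOpFibre_toyModel (A : ℕ → (ℕ → ℝ) → toyCarriers.BgB → Unit → Unit → ℝ) :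
    ¬ ActOpFibre oneIndexing toyAct toyModel Set.univ A :=
  fun h => not_actOpBound_toyModel le_rfl A (actOpBound_of_fibre h zero_le_one)

/-- [folklore] **… AND SO DOES THE STRUCTURAL CLASS**: on the unbased toy `ActOpIntegral` FAILS for every majorant family, every factor
measure, every integrand and every operator domain (`actOpFibre_of_integral` + `not_actOpFibre_toyModel`). -/
theorem not_actOpIntegral_toyModel (A : ℕ → (ℕ → ℝ) → toyCarriers.BgB → Unit → Unit → ℝ) {α : Unit → Unit → Type*}
    [∀ Z j, MeasurableSpace (α Z j)] (μ : ∀ Z j, ℕ → ℂ → Measure (α Z j)) (f : ∀ Z j, ℕ → ℂ → ℂ → α Z j → ℂ)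
    (𝒪 : ℕ → (ℕ → ℝ) → toyCarriers.BgB → ℂ × ℂ → Unit → Unit → Set ℂ) :
    ¬ ActOpIntegral oneIndexing toyAct toyModel Set.univ A μ f 𝒪 :=
  fun h => not_actOpFibre_toyModel A (actOpFibre_of_integral h)

end Summit.QuantumFields.BalabanUV.T4Continuum.B13TermOpFibreWitness

end
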